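import Summits.BirchSwinnertonDyer.BirchSwinnertonDyer.Theorems.Rank1ResidualX9MuTransfer
import Literature.NumberTheory.EllipticCurves.QuadraticTwist
import HarnessLib

/-!
# Class X9: the TWIST CRITERION — the integral main conjecture for `E` from the analytic `μ = 0`
# of ONE admissible quadratic-twist triple, TYPED, and the K6 bridges
# `IntegralMainConjectureOnClassX9` / `BSDpOnClassX9 ⟸ TwistMuTransfer ∧ TwistedAnalyticMuZeroOnClassX9`
# (cell `bsd-smallim`, seat `koly`, gen 4; memo HOME/koly/KOLY-MEMO.md v1.7 §5.8)

HONEST FRAMING (cell `bsd-smallim`, FULL-BSD rank-`≤ 1` programme tranche 1b): provers of the cell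
write PROOFS from published inputs and have them refereed inside the cell; a PASSed memo is a CELL
THEOREM, not a Literature fact and not a kernel proof. This file asserts NOTHING about any curve: it
introduces arithmetic admissibility predicates (plain `def`s over existing tree notions: the
conductor `W.conductorNorm ℤ`, `W.quadraticTwist`, `IsNewformOf`, `padicLFunction`, `unitRoot`), two
`Prop`-valued names (`@[conjecture]`, i.e. OPEN obligation nodes in the kernel's bookkeeping) and
proves, sorry-free, the bridges by which they feed the cell's typed targets of
`Rank1ResidualX9Defs.lean`.

* `TwistMuTransfer` — KOLY-MEMO v1.7 Thm. 5.8.1 (b) in the tree's currency, restricted to X9 pairs: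
  for an X9 pair `(W, p)` and a BCS-admissible pair of discriminants `(d_K, d_F)` (the SPLITTING
  conditions (disc), (Heeg), (spl), (i), (ii), (iii), (vi) of Burungale–Castella–Skinner 2025 §1.2 /
  Prop. 5.2.1; by memo Lemma 5.8.D they imply the Galois conditions (irr_K), (iv), (v) at a good
  ordinary irreducible `p ≥ 5`), ONE `p`-adic unit among the coefficients of the `p`-adic
  `L`-function of EACH of the three twists `W^{d_K}, W^{d_F}, W^{d_Kd_F}` forces the conclusion of
  `IntegralMainConjectureOnClassX9` at `(W, p)`. The memo PROVES this (§5.8: Prop. 5.8.C — the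
  base-change balance `Σ_{A ∈ {E,E^K,E^F,E^{FK}}} μ_alg(A) = Σ μ_an(A)` is an EQUALITY, by BCS 2025
  (1.3) made integral under (irr) via memo Cor. 4.2, Greenberg's 2016 structure theorem "no
  pseudo-null submodule" (Lemma 5.8.B, hypotheses verified), Skinner–Urban's control and
  Castella–Grossi–Skinner's comparison `π⁺ L^{PR}_p(A/K) = L_p(A)·L_p(A^K)` — composed with the
  refereed `μ`-transfer Cor. 5.7.2 applied to the three TWISTS). The referee's word on §5.8 is
  pending at filing time, so the name is an OBLIGATION node, nothing is asserted.
* `TwistedAnalyticMuZeroOnClassX9` — the WEAKENED analytic crux (α′): every X9 pair has an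
  admissible pair `(d_K, d_F)` whose three twists carry the unit-coefficient certificate. Implied by
  Greenberg's analytic `μ = 0` on X9 (`AnalyticMuZeroOnClassX9`, barrier B3) since admissible pairs
  exist (BCS 2025 Lemma 5.2.3) and the twists are X9 pairs again; certified per pair by the lane's
  engines run on three twists; OPEN as a class statement (Prasanna 2010, p. 400: "for a fixed prime
  p, it is not known if there is even a single quadratic discriminant d such that L(1, E_d)^alg is
  non-vanishing mod p"). Nothing asserted.
* `integralMainConjectureOnClassX9_of_twistMuTransfer` — KERNEL: the two nodes give the typed
  rank-`0` engine of X9.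
* `bsdpOnClassX9_of_integralMainConjectureOnClassX9` — KERNEL, reusable by ANY road to the rank-`0`
  engine: the PUBLISHED binders of `X9MuInvariant.lean` (Greenberg 4.1, period unit,
  Perrin-Riou–Schneider, Perrin-Riou 1987, modularity, GZK) ∧ `IntegralMainConjectureOnClassX9` ∧
  the Schneider certificate C3 on the rank-`1` X9 pairs ⟹ `BSDpOnClassX9` (both analytic ranks).
* `bsdpOnClassX9_of_twistMuTransfer` — the composite.

No pair, class, label or count of record is moved by this file.
-/

-- the summit and its single problem are both named `BirchSwinnertonDyer` (registry layout D-0017)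
set_option linter.dupNamespace false

set_option autoImplicit false

noncomputable section

open scoped Classical MatrixGroups ModularForm

open CongruenceSubgroup WeierstrassCurve Field
open Literature.NumberTheory.EllipticCurves Literature.NumberTheory.EllipticCurves.ModularForms
open Literature.NumberTheory.EllipticCurves.Rank1Residual (norm_periodRatio_eq_one pPart_of_bsdp)

namespace Summit.BirchSwinnertonDyer.BirchSwinnertonDyer.Rank1Residual

/-! ### Admissibility predicates (the splitting conditions of BCS 2025) -/

/-- "The prime `ℓ` SPLITS in `ℚ(√d)`" for a discriminant `d` with `ℓ ∤ d`: `d` is a non-zero square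
modulo `ℓ` if `ℓ` is odd, `d ≡ 1 (mod 8)` if `ℓ = 2` (Dedekind–Kummer for the quadratic order;
Neukirch, *Algebraic Number Theory* I.8.5). [folklore] -/
def SplitsInQuadField (d : ℤ) (ℓ : ℕ) : Prop :=
  ¬ (ℓ : ℤ) ∣ d ∧ (ℓ = 2 → d % 8 = 1) ∧ (ℓ ≠ 2 → IsSquare (d : ZMod ℓ))

/-- "The prime `ℓ` is INERT in `ℚ(√d)`" (`ℓ ∤ d`): `d` is a non-square modulo `ℓ` if `ℓ` is odd,
`d ≡ 5 (mod 8)` if `ℓ = 2` (Neukirch I.8.5). [folklore] -/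
def InertInQuadField (d : ℤ) (ℓ : ℕ) : Prop :=
  ¬ (ℓ : ℤ) ∣ d ∧ (ℓ = 2 → d % 8 = 5) ∧ (ℓ ≠ 2 → ¬ IsSquare (d : ZMod ℓ))

/-- **BCS-admissibility of a pair of quadratic discriminants `(d_K, d_F)` for `(W, p)`** — the
SPLITTING conditions of Burungale–Castella–Skinner 2025 (§1.2 and Prop. 5.2.1) for the imaginary
quadratic field `K = ℚ(√d_K)` and the real quadratic field `F = ℚ(√d_F)`, relative to the conductor
`N = W.conductorNorm ℤ`: (disc) `d_K < 0` is an odd fundamental discriminant (square-free,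
`≡ 1 mod 4`), `d_K ≠ -3`; (Heeg) every prime `ℓ ∣ N` splits in `K`; (spl) `p` splits in `K`;
`d_F > 1` an odd fundamental discriminant; (i) `p` inert in `F`; (ii) every prime dividing `d_F`
splits in `K`; (iii) every `ℓ ∣ N` is inert in `F` if `ℓ ≡ -1 (mod p)` and split in `F` otherwise;
(vi) `p = 5 ⟹ F ≠ ℚ(√5)`. The GALOIS conditions (irr_K), (irr_M) for `M = FK` and irreducibility
over `F(ζ_p)` of loc. cit. are OMITTED: at a prime `p ≥ 5` of good ORDINARY reduction with `E[p]`
irreducible they follow from the splitting conditions (KOLY-MEMO v1.7 Lemma 5.8.D: for a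
non-surjective image the only quadratic field over which `ρ̄` becomes reducible is the field of the
Cartan normaliser, which is unramified at `p` and ramified only at primes of `N`; for a surjective
image they are automatic up to (vi)). Such pairs exist for every `(W, p)` with `p ∤ N`, with
positive density (BCS 2025 Lemma 5.2.3: independent splitting conditions).
[cite: BurungaleCastellaSkinner2025, §1.2 (disc)/(Heeg)/(spl), Prop. 5.2.1 (i)–(vi), Lemma 5.2.3] -/
def BCSAdmissiblePair (W : WeierstrassCurve ℚ) [W.IsElliptic] [W.IsGloballyMinimal]
    (p : ℕ) (dK dF : ℤ) : Prop :=
  (dK < 0 ∧ Squarefree dK ∧ dK % 4 = 1 ∧ dK ≠ -3) ∧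
  (∀ ℓ : ℕ, ℓ.Prime → ℓ ∣ W.conductorNorm ℤ → SplitsInQuadField dK ℓ) ∧
  SplitsInQuadField dK p ∧
  (1 < dF ∧ Squarefree dF ∧ dF % 4 = 1) ∧
  InertInQuadField dF p ∧
  (∀ ℓ : ℕ, ℓ.Prime → (ℓ : ℤ) ∣ dF → SplitsInQuadField dK ℓ) ∧
  (∀ ℓ : ℕ, ℓ.Prime → ℓ ∣ W.conductorNorm ℤ →
      (p ∣ ℓ + 1 → InertInQuadField dF ℓ) ∧ (¬ p ∣ ℓ + 1 → SplitsInQuadField dF ℓ)) ∧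
  (p = 5 → dF ≠ 5)

/-- **"`μ(L_p(E^d)) = 0`" in the tree's currency — the lane's unit-coefficient certificate run on the
quadratic twist.** There is a globally minimal Weierstrass model `W'` over `ℚ` of the quadratic
twist `W^d` (`W' ≅_ℚ W.quadraticTwist d`), a newform `f'` of `W'`, and an index `n` with
`‖[Tⁿ] L_p(f', α(W'))‖_p = 1`: some coefficient of the `p`-adic `L`-function of the twist (unit root
`α(W') = unitRoot W' p`, Mazur–Tate–Teitelbaum) is a `p`-adic unit. (Every `E^d` has a global minimal
model and a newform — Néron, modularity —; the content is the unit coefficient.)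
[cite: MazurTateTeitelbaum1986Invent, §I.11–§I.13] [cite: GreenbergLNM1716, §1 Conj. 1.11] -/
def TwistHasUnitCoeff (W : WeierstrassCurve ℚ) (p : ℕ) [Fact p.Prime] (d : ℤ) : Prop :=
  ∃ (W' : WeierstrassCurve ℚ) (_ : W'.IsElliptic) (_ : W'.IsGloballyMinimal),
    (∃ C : WeierstrassCurve.VariableChange ℚ, C • W.quadraticTwist (d : ℚ) = W') ∧
    ∃ (N' : ℕ) (_ : NeZero N') (f' : CuspForm (Gamma0 N') 2), IsNewformOf W' f' ∧
      ∃ n : ℕ, ‖PowerSeries.coeff n (padicLFunction f' (unitRoot W' p : ℚ_[p]))‖ = 1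

/-! ### The two K6 inputs of the twist road, typed -/

/-- **KOLY-MEMO v1.7 Thm. 5.8.1 (b) on X9 — the TWIST `μ`-TRANSFER (cell theorem on paper; OPEN
obligation node in the kernel, nothing asserted).** For every X9 pair `(W, p)`
(`Rank1ResidualX9Defs.ClassX9`: non-CM, `p ≥ 5` good ordinary, `E[p]` irreducible, `ρ̄` not
surjective) and every BCS-admissible pair of discriminants `(d_K, d_F)`: if EACH of the three
quadratic twists `W^{d_K}, W^{d_F}, W^{d_Kd_F}` carries the unit-coefficient certificate
(`TwistHasUnitCoeff`), then for all cyclotomic data `(κ, γ)`, every newform `f` of `W` and every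
Selmer dual datum `D`: `X` is torsion and `char_Λ X = (g)` with `ι g = L_p(f, α)` — the conclusion of
`IntegralMainConjectureOnClassX9` at the pair. Memo proof (§5.8): by the refereed `μ`-transfer
(Cor. 5.7.2, = `KatoMuTransfer`) each twist `A` has `μ_alg(A) = μ_an(A) = 0`; the four-term balance
`Σ_{A ∈ {E, E^K, E^F, E^{FK}}} (μ_alg(A) - μ_an(A)) = 0` (Prop. 5.8.C(i): BCS 2025 (1.3) in `Λ_K`,
integral under (irr) by memo Cor. 4.2(b) = BCK21 Thm. 3.1; cyclotomic specialisation with NO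
pseudo-null error by Greenberg 2016 Prop. 4.1.1(b) — Lemmas 5.8.A/B —, Skinner–Urban 2014
Prop. 3.2.11/Lemma 3.2.5 control, Castella–Grossi–Skinner 2023 Prop. 1.2.4) then gives
`μ_alg(E) = μ_an(E)`, and BCS 2025 Thm. 1.1.2 (a) (`ch X = (p^k L_p)`, tree fact `hBCS`) pins
`k = 0`. [cite: BurungaleCastellaSkinner2025, Thm. 1.1.2 (a), Prop. 5.2.1, Cor. 4.1.4, (1.3) and proof of Thm. 1.4.1 (arXiv:2405.00270v2 pp. 5, 8–11)]
[cite: GreenbergSelmerStructure2016, Prop. 4.1.1 (b) and §4.3] [cite: SkinnerUrban2014, Prop. 3.2.11, Lemma 3.2.5, Lemma 3.1.7]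
[cite: CastellaGrossiSkinner2025, Prop. 1.2.4] [cite: Kato2004Asterisque, Thm. 12.6, 17.13] -/
@[conjecture] def TwistMuTransfer : Prop :=
  ∀ (W : WeierstrassCurve ℚ) [W.IsElliptic] [W.IsGloballyMinimal] (p : ℕ) [Fact p.Prime]
    (dK dF : ℤ), ClassX9 W p → BCSAdmissiblePair W p dK dF →
    TwistHasUnitCoeff W p dK → TwistHasUnitCoeff W p dF → TwistHasUnitCoeff W p (dK * dF) →
    ∀ (κ : ZpExtension ℚ p) (γ : Field.absoluteGaloisGroup ℚ) {N : ℕ} [NeZero N]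
      (f : CuspForm (Gamma0 N) 2),
      κ.IsCyclotomic → κ.IsTopGenerator γ → IsCyclotomicVariable p γ → IsNewformOf W f →
      ∀ D : W.SelmerDualData κ γ,
        D.IsTorsion ∧ ∃ g : IwasawaAlgebra p, D.charIdeal = Ideal.span {g} ∧
          iwasawaToPowerSeries p g = padicLFunction f (unitRoot W p : ℚ_[p])

/-- **(α′) — Greenberg's analytic `μ = 0` for ONE admissible twist triple, on class X9 (OPEN as a
class statement; certified per pair; nothing asserted).** For every X9 pair `(W, p)` there are
discriminants `(d_K, d_F)`, BCS-admissible for `(W, p)`, such that each of the three quadratic twists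
`W^{d_K}, W^{d_F}, W^{d_Kd_F}` has a `p`-adic unit among the coefficients of its `p`-adic
`L`-function. WEAKER than `AnalyticMuZeroOnClassX9` (admissible pairs exist for every X9 pair, BCS
2025 Lemma 5.2.3, and the twists are X9 pairs again, so Greenberg's Conj. 1.11 for X9 implies it);
STRICTLY an existential statement over an infinite positive-density family of twists per pair. In
print the existence of even one quadratic twist with `p`-indivisible central value is open at a fixed
`p` (Prasanna 2010, p. 400); Ono–Skinner 1998 / Chida 2015 give it only for all but finitely many
`p`. [cite: GreenbergLNM1716, §1 Conj. 1.11] [cite: Prasanna2010CJM, p. 400 (Introduction)]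
[cite: BurungaleCastellaSkinner2025, Lemma 5.2.3] -/
@[conjecture] def TwistedAnalyticMuZeroOnClassX9 : Prop :=
  ∀ (W : WeierstrassCurve ℚ) [W.IsElliptic] [W.IsGloballyMinimal] (p : ℕ) [Fact p.Prime],
    ClassX9 W p → ∃ dK dF : ℤ, BCSAdmissiblePair W p dK dF ∧
      TwistHasUnitCoeff W p dK ∧ TwistHasUnitCoeff W p dF ∧ TwistHasUnitCoeff W p (dK * dF)

/-! ### Kernel bridges -/

/-- **K6 rank-`0` engine from the twist road (KERNEL).** `TwistMuTransfer` (memo Thm. 5.8.1 (b),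
paper) ∧ `TwistedAnalyticMuZeroOnClassX9` (the weakened analytic crux (α′)) ⟹
`IntegralMainConjectureOnClassX9`. Proof: instantiate the transfer at the admissible pair supplied by
(α′). [folklore] -/
theorem integralMainConjectureOnClassX9_of_twistMuTransfer
    (hT : TwistMuTransfer) (hA : TwistedAnalyticMuZeroOnClassX9) :
    IntegralMainConjectureOnClassX9 := by
  intro W _ _ p _ κ γ N _ f hX9 hκ hγ hγ' hf D
  obtain ⟨dK, dF, hadm, hK, hF, hKF⟩ := hA W p hX9
  exact hT W p dK dF hX9 hadm hK hF hKF κ γ f hκ hγ hγ' hf D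

/-- **`BSDpOnClassX9` from the typed rank-`0` engine ALONE, both analytic ranks (KERNEL; reusable by
every road to `IntegralMainConjectureOnClassX9`).** PUBLISHED binders, exactly those of
`bsdpOnClassX9_of_katoMuTransfer` minus BCS (a): Greenberg LNM 1716 Thm. 4.1 (`hGr`), the period unit
`Ω_E = u·Ω⁺_f` (`h5`), Perrin-Riou–Schneider (`hS`), Perrin-Riou 1987 (`hPR`), modularity (`hmodP`,
`hmodL`), Gross–Zagier–Kolyvagin (`hGZK`). TYPED input: `IntegralMainConjectureOnClassX9` (`hIMC`).
RIDER (I1): the Schneider certificate C3 at the rank-`1` X9 pairs (`hC3`). Deduction: the integral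
main conjecture at the pair, rescaled by the unit `ϖ` (`‖ϖ‖_p = 1`, `norm_periodRatio_eq_one`), is
Mazur's main conjecture in the Néron normalisation; rank `0`: CGLS 2022 Thm. 5.1.4's valuation chain
(`padicValRat_bsd_rank_zero_of_mazurMainConjecture`, `bsdp_of_padicValRat_rank_zero`); rank `1`:
Wuthrich's engine (`Wuthrich2014.missingPPartAt_of_mainConjecture_of_rank_one`,
`Typed.bsdp_of_missingPPartAt`); then Miller's `BSD(E,p)` back to the print shape (`pPart_of_bsdp`,
`pPartBSD_iff_pPart`). No certificate for `W` itself is needed on this road.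
[cite: GreenbergLNM1716, Thm. 4.1 (p. 102)] [cite: CastellaEtAl2021, Thm. 5.1.4 and its proof (§5.1.3)]
[cite: PerrinRiou1987, §1.4 Cor. 1.8] [cite: Miller2011LMS, §1 and Def. 1.1] -/
theorem bsdpOnClassX9_of_integralMainConjectureOnClassX9
    (hGr : greenberg_charValue_rankZero) (h5 : realPeriodRat_eq_unit_mul_plusPeriod)
    (hS : Schneider1985_order_charGenerator) (hPR : perrinRiou_rankOne_leadingTerms)
    (hmodP : nonempty_modularParametrizationData) (hmodL : hasEntireLFunction_rat)
    (hGZK : rank_eq_analyticRank_of_analyticRank_le_one)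
    (hIMC : IntegralMainConjectureOnClassX9)
    (hC3 : ∀ (W : WeierstrassCurve ℚ) [W.IsElliptic] [W.IsGloballyMinimal] (p : ℕ) [Fact p.Prime],
      ClassX9 W p → W.analyticRank = 1 →
        ∀ Dh : PAdicHeightData W p, Dh.IsCanonical → SchneiderConjecture Dh) :
    BSDpOnClassX9 := by
  intro W _ _ p _ hran hX9 hfin
  obtain ⟨-, hp, hgood, hord, hirr, -⟩ := id hX9
  -- Mazur's main conjecture in the Néron normalisation, from the integral main conjecture and `ϖ`
  have hMC : ∀ (κ : ZpExtension ℚ p) (γ : Field.absoluteGaloisGroup ℚ),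
        κ.IsCyclotomic → κ.IsTopGenerator γ → IsCyclotomicVariable p γ →
      ∀ [NeZero (W.conductorNorm ℤ)] (f : CuspForm (Gamma0 (W.conductorNorm ℤ)) 2),
        IsNewformOf W f → ∀ (ϖ : ℚ), (ϖ : ℝ) * W.realPeriodRat = plusPeriod f →
      ∀ (D : W.SelmerDualData κ γ), D.IsTorsion ∧
        ∃ g : IwasawaAlgebra p, D.charIdeal = Ideal.span {g} ∧
          iwasawaToPowerSeries p g =
            PowerSeries.C (ϖ : ℚ_[p]) * padicLFunction f (unitRoot W p : ℚ_[p]) := by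
    intro κ γ hκ hγ hγ' _ f hf ϖ hϖeq D
    obtain ⟨htors, g, hchar, hιg⟩ := hIMC W p κ γ f hX9 hκ hγ hγ' hf D
    have hϖnorm : ‖(ϖ : ℚ_[p])‖ = 1 := norm_periodRatio_eq_one h5 W p hp hgood hirr f hf ϖ hϖeq
    set c : ℤ_[p] := ⟨(ϖ : ℚ_[p]), hϖnorm.le⟩ with hc_def
    have hcu : IsUnit c := PadicInt.isUnit_iff.mpr hϖnorm
    refine ⟨htors, PowerSeries.C c * g, ?_, ?_⟩
    · rw [hchar]
      exact (Ideal.span_singleton_mul_left_unit (hcu.map PowerSeries.C) g).symm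
    · rw [map_mul, hιg, PowerSeries.map_C]
      rfl
  have hbsdp : BSDp W p := by
    rcases Nat.le_one_iff_eq_zero_or_eq_one.mp hran with hr | hr
    · -- analytic rank 0: CGLS's valuation chain
      have hp2 : p ≠ 2 := by omega
      have hL : W.entireLFunction 1 ≠ 0 := (W.analyticRank_eq_zero_iff_holds (hmodL W)).1 hr
      exact bsdp_of_padicValRat_rank_zero W p hr hL hGZK
        (padicValRat_bsd_rank_zero_of_mazurMainConjecture W p hgood hord hL hfin hmodP
          (hGr W p hp2 hgood hord) hMC)
    · -- analytic rank 1: Wuthrich's engine, Schneider certificate supplied by `hC3`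
      exact Literature.NumberTheory.EllipticCurves.Rank1Residual.Typed.bsdp_of_missingPPartAt W p hGZK
        (by omega)
        (Wuthrich2014.missingPPartAt_of_mainConjecture_of_rank_one hS hPR hmodP hGZK W p hp hgood
          hord hr (hC3 W p hX9 hr) hMC)
  exact (pPartBSD_iff_pPart W p).mpr (pPart_of_bsdp hmodL hGZK W p hran hbsdp)

/-- **K6 leaf from the twist road (KERNEL): `BSDpOnClassX9 ⟸ TwistMuTransfer ∧ (α′) ∧ C3 ∧ PUB`.**
The composite of `integralMainConjectureOnClassX9_of_twistMuTransfer` and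
`bsdpOnClassX9_of_integralMainConjectureOnClassX9`; binders as there. Nothing is booked: the two
cell inputs are open nodes. [cite: GreenbergLNM1716, Thm. 4.1 (p. 102) and §1 Conj. 1.11]
[cite: BurungaleCastellaSkinner2025, Thm. 1.1.2 (a)] -/
theorem bsdpOnClassX9_of_twistMuTransfer
    (hGr : greenberg_charValue_rankZero) (h5 : realPeriodRat_eq_unit_mul_plusPeriod)
    (hS : Schneider1985_order_charGenerator) (hPR : perrinRiou_rankOne_leadingTerms)
    (hmodP : nonempty_modularParametrizationData) (hmodL : hasEntireLFunction_rat)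
    (hGZK : rank_eq_analyticRank_of_analyticRank_le_one)
    (hT : TwistMuTransfer) (hA : TwistedAnalyticMuZeroOnClassX9)
    (hC3 : ∀ (W : WeierstrassCurve ℚ) [W.IsElliptic] [W.IsGloballyMinimal] (p : ℕ) [Fact p.Prime],
      ClassX9 W p → W.analyticRank = 1 →
        ∀ Dh : PAdicHeightData W p, Dh.IsCanonical → SchneiderConjecture Dh) :
    BSDpOnClassX9 :=
  bsdpOnClassX9_of_integralMainConjectureOnClassX9 hGr h5 hS hPR hmodP hmodL hGZK
    (integralMainConjectureOnClassX9_of_twistMuTransfer hT hA) hC3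

end Summit.BirchSwinnertonDyer.BirchSwinnertonDyer.Rank1Residual
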